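import Summits.Ventures.Crystal3D.Bulk.HullSubmapEars
import Summits.Ventures.Crystal3D.Bulk.GapActiveHull
import Summits.Ventures.Crystal3D.Bulk.GapSubHullEuler
import Summits.Ventures.Crystal3D.Bulk.GapSubHullCorners
import HarnessLib

/-!
# LEMMA L for the GAP census: every oriented face of the tight map of a census configuration is
# a CONVEX spherical polygon (route 1 of `HOME/lean/lemmaL/DESIGN.md`, the assembly)

HONEST FRAMING. Part of the venture `Summits/Ventures/Crystal3D` (cell `pub-crystal3d`, phase 2;
seat p3). Kernel theorem about every configuration satisfying typer-bulk-2's `CensusRows c`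
(`Bulk/GapCensusRows.lean`); nothing is claimed about GAP(1.26). LEMMA L of the cell's
`phase2/ENV-CENSUS/DESIGN-L12-THEORY.md` §P-L3 ("every face of `T′` is a convex spherical
polygon") was until now an assumption of the census enumeration (plantri class, convex-face LP
rows). Here it becomes a census row: read the tight map inside the hull fan of the ACTIVE
directions `D° = activeDirSet c` (`Bulk/GapActiveHull.lean`; `0` interior by L3,
`Bulk/GapActiveHemisphere.lean`), where it covers every vertex, is connected
(`CensusRows.tightConnected`, `Bulk/GapSubHullEuler.lean`) and has all corners `< π`
(P-L2(a), `Bulk/GapSubHullCorners.lean`); the generic ear induction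
(`HullRotSys.faceConvex_of_cover`, `Bulk/HullSubmapEars.lean`) then gives:

* `CensusRows.faceConvex_active` — `FaceConvex` for the walk of every tight dart in `D°`;
* **`CensusRows.orient3_oface_neg`** — in census vocabulary: for every dart `q` of the tight
  map and all `i < j < k < ofaceLen c q`,
  `orient3 (gapDir c (φ°^[i] q).1) (gapDir c (φ°^[j] q).1) (gapDir c (φ°^[k] q).1) < 0`
  (`φ° = ofaceSucc c`): the vertex cycle of every oriented face, in walk order, is in (clockwise)
  convex position — LEMMA L;
* `CensusRows.fst_iterate_ofaceSucc_injOn` — hence the vertices of a face walk are pairwise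
  distinct: every face boundary is a SIMPLE cycle (the tight map has no cut vertex, P-L3(b) L2).
-/

noncomputable section

namespace Summit.Ventures.Crystal3D

open Literature.Geometry.DiscreteGeometry Finset Equiv HullRotSys Function

variable {c : Fin 14 → EuclideanSpace ℝ (Fin 3)}

/-! ## The tight map in the active hull satisfies the hypotheses of the ear induction -/

/-- Every active direction is the tail of a tight dart: the tight map COVERS the active hull. -/
theorem CensusRows.cover_active (h : CensusRows c) :
    ∀ y ∈ activeDirSet c, ∃ z ∈ tightDartsIn c (activeDirSet c), z.1.1 = y := by
  intro y hy
  obtain ⟨i, hi, rfl⟩ := mem_activeDirSet.1 hy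
  obtain ⟨hi0, j, hj⟩ := mem_activeVertices.1 hi
  have hq : (i, j) ∈ darts c := mk_mem_darts hi0 hj
  exact ⟨⟨dirPair c (i, j), h.dirPair_mem_hullDarts_active _ hq⟩,
    mem_tightDartsIn.2 ⟨(i, j), hq, rfl⟩, rfl⟩

/-- The tight map is CONNECTED in the active hull (`numK = 1`). -/
theorem CensusRows.numK_active (h : CensusRows c) :
    RotSys.numK (rot h.isGapConfig.norm_of_mem_activeDirSet h.zero_mem_interior_convexHull_activeDirSet)
      (inv (activeDirSet c)) (tightDartsIn c (activeDirSet c)) = 1 :=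
  h.isGapConfig.numK_eq_one_of_tightConnected_of _ _ h.dirPair_mem_hullDarts_active
    h.tightConnected h.darts_nonempty

/-- **LEMMA L in the active hull.** The walk of every tight dart is convex. -/
theorem CensusRows.faceConvex_active (h : CensusRows c) {d : ↥(hullDarts (activeDirSet c))}
    (hd : d ∈ tightDartsIn c (activeDirSet c)) :
    FaceConvex h.isGapConfig.norm_of_mem_activeDirSet h.zero_mem_interior_convexHull_activeDirSet
      (tightDartsIn c (activeDirSet c)) d :=
  faceConvex_of_cover (isClosed_tightDartsIn c _) h.cover_active h.numK_active
    (fun _ hz => h.cornerAt_tightDartsIn_lt_pi _ _ h.dirPair_mem_hullDarts_active hz) hd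

/-! ## Translation to the census vocabulary -/

/-- The walk of the tight dart `d ↦ q` visits the tails of the iterates `φ°^[t] q`. -/
theorem CensusRows.faceVertex_active_eq (h : CensusRows c) {q : Fin 14 × Fin 14} (hq : q ∈ darts c)
    (t : ℕ) :
    faceVertex h.isGapConfig.norm_of_mem_activeDirSet h.zero_mem_interior_convexHull_activeDirSet
      (tightDartsIn c (activeDirSet c)) ⟨dirPair c q, h.dirPair_mem_hullDarts_active q hq⟩ t =
      gapDir c ((ofaceSucc c)^[t] q).1 := by
  unfold faceVertex faceDart
  rw [h.isGapConfig.phi_pow_rot_val_of h.intruderDist_lt_three_halves _ _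
    h.dirPair_mem_hullDarts_active hq rfl t]
  rfl

/-- The period of the walk of `d ↦ q` is the face length `ofaceLen c q = #(ofaceOf c q)`. -/
theorem CensusRows.facePeriod_active_eq (h : CensusRows c) {q : Fin 14 × Fin 14} (hq : q ∈ darts c) :
    facePeriod h.isGapConfig.norm_of_mem_activeDirSet h.zero_mem_interior_convexHull_activeDirSet
      (tightDartsIn c (activeDirSet c)) ⟨dirPair c q, h.dirPair_mem_hullDarts_active q hq⟩ =
      ofaceLen c q := by
  have hD := h.intruderDist_lt_three_halves
  have hD2 : intruderDist c < 2 := by linarith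
  have hD3 := h.intruderDist_bounds.1
  have hval := fun t => h.isGapConfig.phi_pow_rot_val_of hD h.isGapConfig.norm_of_mem_activeDirSet
    h.zero_mem_interior_convexHull_activeDirSet h.dirPair_mem_hullDarts_active hq
    (d := ⟨dirPair c q, h.dirPair_mem_hullDarts_active q hq⟩) rfl t
  unfold facePeriod
  refine RotSys.minimalPeriod_eq_of_first_return _ _ (h.isGapConfig.ofaceLen_pos hD3 hq) ?_ ?_
  · apply Subtype.ext
    rw [hval, iterate_ofaceLen]
  · intro k hk0 hk heq
    have hv := congrArg Subtype.val heq
    rw [hval] at hv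
    have hper : (ofaceSucc c)^[k] q = q :=
      h.isGapConfig.dirPair_injOn hD2 (Finset.mem_coe.2 (h.isGapConfig.iterate_ofaceSucc_mem_darts hD3 hq k))
        (Finset.mem_coe.2 hq) hv
    have := iterate_injOn_Iio_minimalPeriod (f := ofaceSucc c) (x := q)
      (Set.mem_Iio.2 hk) (Set.mem_Iio.2 (h.isGapConfig.ofaceLen_pos hD3 hq))
      (by show (ofaceSucc c)^[k] q = (ofaceSucc c)^[0] q; rw [hper]; rfl)
    omega

/-- **LEMMA L (census form): every oriented face of the tight map is a convex spherical polygon.**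
For every dart `q` of the tight map of a census configuration and all `i < j < k < ofaceLen c q`,
the directions of the tails of `φ°^[i] q, φ°^[j] q, φ°^[k] q` are NEGATIVELY oriented (the walk
runs clockwise seen from outside the unit sphere): the vertex cycle of the face is in convex
position. -/
theorem CensusRows.orient3_oface_neg (h : CensusRows c) {q : Fin 14 × Fin 14} (hq : q ∈ darts c)
    {i j k : ℕ} (hij : i < j) (hjk : j < k) (hk : k < ofaceLen c q) :
    orient3 (gapDir c ((ofaceSucc c)^[i] q).1) (gapDir c ((ofaceSucc c)^[j] q).1)
      (gapDir c ((ofaceSucc c)^[k] q).1) < 0 := by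
  have hconv := h.faceConvex_active (mem_tightDartsIn.2 ⟨q, hq, rfl⟩
    : (⟨dirPair c q, h.dirPair_mem_hullDarts_active q hq⟩ : ↥(hullDarts (activeDirSet c))) ∈ _)
  rw [faceConvex_iff_orient3_neg] at hconv
  have := hconv i j k hij hjk (by rw [h.facePeriod_active_eq hq]; exact hk)
  rwa [h.faceVertex_active_eq hq, h.faceVertex_active_eq hq, h.faceVertex_active_eq hq] at this

/-- **The vertices of a face walk are pairwise distinct** (a convex polygon is simple): for
`i < j < ofaceLen c q` the tails of `φ°^[i] q` and `φ°^[j] q` differ. Hence no face boundary of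
the tight map passes twice through a vertex (no cut vertex, P-L3(b) L2). -/
theorem CensusRows.fst_iterate_ofaceSucc_injOn (h : CensusRows c) {q : Fin 14 × Fin 14}
    (hq : q ∈ darts c) {i j : ℕ} (hij : i < j) (hj : j < ofaceLen c q) :
    ((ofaceSucc c)^[i] q).1 ≠ ((ofaceSucc c)^[j] q).1 := by
  intro heq
  have h3 := h.three_le_ofaceLen hq
  -- a third index `k ∉ {i, j}` below the period
  obtain ⟨k, hk, hki, hkj⟩ : ∃ k, k < ofaceLen c q ∧ k ≠ i ∧ k ≠ j := by
    by_cases h0 : i = 0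
    · by_cases h1 : j = 1
      · exact ⟨2, by omega, by omega, by omega⟩
      · exact ⟨1, by omega, by omega, by omega⟩
    · exact ⟨0, by omega, by omega, by omega⟩
  -- orient the triple increasingly; two equal vectors make `orient3` vanish
  have hzero : ∀ a b d : ℕ, a < b → b < d → d < ofaceLen c q →
      (gapDir c ((ofaceSucc c)^[a] q).1 = gapDir c ((ofaceSucc c)^[b] q).1 ∨
       gapDir c ((ofaceSucc c)^[a] q).1 = gapDir c ((ofaceSucc c)^[d] q).1 ∨
       gapDir c ((ofaceSucc c)^[b] q).1 = gapDir c ((ofaceSucc c)^[d] q).1) → False := by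
    intro a b d hab hbd hd hor
    have hneg := h.orient3_oface_neg hq hab hbd hd
    rcases hor with e | e | e
    · rw [e, orient3_self_left] at hneg; exact lt_irrefl _ hneg
    · rw [e, orient3_self_outer] at hneg; exact lt_irrefl _ hneg
    · rw [e, orient3_self_right] at hneg; exact lt_irrefl _ hneg
  have e : gapDir c ((ofaceSucc c)^[i] q).1 = gapDir c ((ofaceSucc c)^[j] q).1 := by rw [heq]
  rcases Nat.lt_or_gt_of_ne hki with hki' | hki'
  · exact hzero k i j hki' hij hj (Or.inr (Or.inr e))
  · rcases Nat.lt_or_gt_of_ne hkj with hkj' | hkj'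
    · exact hzero i k j hki' hkj' hj (Or.inr (Or.inl e))
    · exact hzero i j k hij hkj' hk (Or.inl e)

end Summit.Ventures.Crystal3D
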